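import Summits.ValiantsHypothesis.ValiantsHypothesis.Theses.ChowBorderDepth3
import Literature.Computability.AlgebraicComplexity.CircuitGateSemantics

/-!
# `ChowBorderDepth3.SPSNormalForm` (stmt-ValiantsHypothesis-5939) — product-depth-one circuits are `ΣΠΣ` expressions

`SPSNormalForm_proof : Theses.ChowBorderDepth3.SPSNormalForm`: a circuit of product-depth `≤ 1`
with `E` wires computing `per_n` over `ℂ` yields polynomials `ℓ i j` (`i, j < E + 1`) of total
degree `≤ 1` with `∑ i, ∏ j, ℓ i j = per_n` (Landsberg 2017 §7.1; Bürgisser–Clausen–Shokrollahi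
1997 Ch. 21: a `ΣΠΣ` circuit *is* a sum of products of affine forms).

The content is the structural lemma `exists_sps_of_productDepth_le_one`, valid for every circuit
`P : ArithCircuit k σ` over any commutative semiring and any variable type, with `P.eval` in place
of `per_n`. It is run on the per-gate semantics of
`Literature/Computability/AlgebraicComplexity/CircuitGateSemantics.lean` (`gateVal`, `opVal`,
`gatePD`, `opPD`):

* a gate of product-depth `0` is a weighted-sum gate all of whose operands have product-depth `0`
  (or an empty product gate, value `1`), so by strong induction along the gate list it computes a
  polynomial of total degree `≤ 1` (`totalDegree_gateVal_le_one`); junk references are `0`;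
* the operands of a product gate of product-depth `≤ 1` have product-depth `0`, so its value is a
  product of `fanIn` polynomials of degree `≤ 1` (`totalDegree_opVal_arg_le_one`);
* a sum gate of product-depth `≤ 1` computes `A + ∑_p c_p • v_p` with `A` of degree `≤ 1`, the sum
  over the product gates `p` with NONEMPTY operand list and product-depth `≤ 1`, `v_p` their
  values (`exists_affine_add_sum`; empty product gates go into `A`);
* there are at most `∑ fanIn = E` nonempty product gates, each of fan-in `≤ E`; carrying the scalar
  `c_p` as an extra constant factor gives at most `E + 1` rows of at most `E + 1` factors, and the
  table is completed with factors `1` and zero rows (`exists_table_of_rows`).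

No named facts are used; the file is unconditional.
-/

namespace Summit.ValiantsHypothesis.ValiantsHypothesis.Theorems

-- `Summit.ValiantsHypothesis.ValiantsHypothesis.…` is the tree's mandated single-conjunct layout (Sub = Summit).
set_option linter.dupNamespace false

open MvPolynomial
open Literature.Computability.AlgebraicComplexity ArithCircuit

section Tables

variable {α R : Type*} [CommSemiring R]

/-- `∑_{p < |l|} f(l[p]) = ∑ (l.map f)` (the out-of-range junk `0` is never reached). [folklore] -/
theorem sum_range_getElem?_map_getD (f : α → ℕ) (l : List α) :
    ∑ p ∈ Finset.range l.length, ((l[p]?).map f).getD 0 = (l.map f).sum := by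
  induction l with
  | nil => simp
  | cons a l ih =>
    rw [List.length_cons, Finset.sum_range_succ']
    simp only [List.getElem?_cons_succ, List.getElem?_cons_zero, Option.map_some,
      Option.getD_some, ih, List.map_cons, List.sum_cons]
    exact add_comm _ _

/-- Padding a row with factors `1`: `∏_{j < M} row.getD j 1 = row.prod` once `|row| ≤ M`. [folklore] -/
theorem prod_range_getD_one_of_length_le (row : List R) {M : ℕ} (h : row.length ≤ M) :
    ∏ j ∈ Finset.range M, row.getD j 1 = row.prod := by
  induction row generalizing M with
  | nil => simp
  | cons a row ih =>
    obtain ⟨M, rfl⟩ : ∃ M', M = M' + 1 := ⟨M - 1, by simp at h; omega⟩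
    rw [Finset.prod_range_succ']
    simp only [List.getD_cons_succ, List.getD_cons_zero, List.prod_cons]
    rw [ih (by simpa using h), mul_comm]

/-- `∑_{i < |L|} (L.getD i []).prod = ∑ (L.map prod)`. [folklore] -/
theorem sum_range_prod_getD_nil (L : List (List R)) :
    ∑ i ∈ Finset.range L.length, (L.getD i []).prod = (L.map List.prod).sum := by
  induction L with
  | nil => simp
  | cons a L ih =>
    rw [List.length_cons, Finset.sum_range_succ']
    simp only [List.getD_cons_succ, List.getD_cons_zero, ih, List.map_cons, List.sum_cons]
    exact add_comm _ _

variable {σ : Type*}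

/-- Padding: a list of at most `M` rows, each of at most `M` polynomials of total degree `≤ 1`,
is realised by an `M × M` table of such polynomials with the same sum of row products (short rows
are padded with the factor `1`, missing rows are zero rows). [folklore] -/
theorem exists_table_of_rows {M : ℕ} (L : List (List (MvPolynomial σ R))) (hL : L.length ≤ M)
    (hrow : ∀ row ∈ L, row.length ≤ M) (hdeg : ∀ row ∈ L, ∀ f ∈ row, f.totalDegree ≤ 1) :
    ∃ ℓ : Fin M → Fin M → MvPolynomial σ R, (∀ i j, (ℓ i j).totalDegree ≤ 1) ∧
      ∑ i, ∏ j, ℓ i j = (L.map List.prod).sum := by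
  have hmem : ∀ i : ℕ, i < L.length → L.getD i [] ∈ L := fun i hi => by
    rw [List.getD_eq_getElem _ _ hi]; exact List.getElem_mem hi
  refine ⟨fun i j => if (i : ℕ) < L.length then (L.getD i []).getD j 1 else 0, ?_, ?_⟩
  · intro i j
    dsimp only
    split_ifs with hi
    · rw [List.getD_eq_getElem?_getD]
      cases hf : (L.getD (i : ℕ) [])[(j : ℕ)]? with
      | none => simp
      | some f => simpa using hdeg _ (hmem i hi) f (List.mem_of_getElem? hf)
    · simp
  · have hrows : ∀ i : Fin M,
        (∏ j : Fin M, if (i : ℕ) < L.length then (L.getD i []).getD j 1 else 0) =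
          if (i : ℕ) < L.length then (L.getD i []).prod else 0 := by
      intro i
      split_ifs with hi
      · rw [Fin.prod_univ_eq_prod_range (fun j => (L.getD i []).getD j 1) M]
        exact prod_range_getD_one_of_length_le _ (hrow _ (hmem i hi))
      · exact Finset.prod_eq_zero (Finset.mem_univ i) rfl
    simp only [hrows]
    rw [Fin.sum_univ_eq_sum_range (fun i => if i < L.length then (L.getD i []).prod else 0) M,
      ← sum_range_prod_getD_nil, ← Finset.sum_subset (Finset.range_mono hL)]
    · exact Finset.sum_congr rfl fun i hi => if_pos (Finset.mem_range.1 hi)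
    · exact fun i _ hi => if_neg fun h => hi (Finset.mem_range.2 h)

end Tables

section Circuits

variable {k : Type*} [CommSemiring k] {σ : Type*}

/-- An operand of product-depth `0` (as seen by gate `i`) denotes a polynomial of total degree
`≤ 1`, provided every earlier gate of product-depth `0` does. [folklore] -/
theorem totalDegree_opVal_le_one (P : ArithCircuit k σ) {i : ℕ} (u : Operand k σ)
    (hu : P.opPD i u = 0) (ih : ∀ j < i, P.gatePD j = 0 → (P.gateVal j).totalDegree ≤ 1) :
    (P.opVal i u).totalDegree ≤ 1 := by
  cases u with
  | var v => exact (isHomogeneous_X k v).totalDegree_le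
  | const c => simp
  | gate j =>
    rw [opVal_gate]
    rw [opPD_gate] at hu
    split_ifs at hu ⊢ with hj
    · exact ih j hj hu
    · simp

/-- **Product-depth `0` gates are affine**: a gate of product-depth `0` is a weighted sum of
operands of product-depth `0` (or an empty product, value `1`), hence computes a polynomial of
total degree `≤ 1` (strong induction along the gate list). [folklore] -/
theorem totalDegree_gateVal_le_one (P : ArithCircuit k σ) :
    ∀ i, P.gatePD i = 0 → (P.gateVal i).totalDegree ≤ 1 := by
  intro i
  induction i using Nat.strong_induction_on with
  | _ i ih =>
    intro hD
    by_cases hi : i < P.size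
    · obtain ⟨g, hg⟩ : ∃ g, P.gates[i]? = some g := ⟨_, List.getElem?_eq_getElem hi⟩
      cases g with
      | prod l =>
        cases l with
        | nil => rw [P.gateVal_of_prod hg]; simp
        | cons u l =>
          have := P.opPD_succ_le_gatePD_of_prod hg List.mem_cons_self
          omega
      | sum l =>
        rw [P.gateVal_of_sum hg]
        have hargs : ∀ a ∈ l, P.opPD i a.2 = 0 := fun a ha => by
          have := P.opPD_le_gatePD_of_sum hg ha; omega
        clear hg
        induction l with
        | nil => simp
        | cons a l ihl =>
          rw [List.map_cons, List.sum_cons]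
          refine (totalDegree_add _ _).trans (max_le ?_ (ihl fun b hb => hargs b (by simp [hb])))
          exact (totalDegree_smul_le _ _).trans
            (totalDegree_opVal_le_one P a.2 (hargs a (by simp)) fun j hj hDj => ih j hj hDj)
    · rw [P.gateVal_of_le (not_lt.1 hi)]; simp

/-- The operands of a product gate of product-depth `≤ 1` denote polynomials of total degree
`≤ 1` (they have product-depth `0`). [folklore] -/
theorem totalDegree_opVal_arg_le_one (P : ArithCircuit k σ) {p : ℕ} {l : List (Operand k σ)}
    (hp : P.gates[p]? = some (.prod l)) (hD : P.gatePD p ≤ 1) :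
    ∀ u ∈ l, (P.opVal p u).totalDegree ≤ 1 := fun u hu => by
  have := P.opPD_succ_le_gatePD_of_prod hp hu
  exact totalDegree_opVal_le_one P u (by omega) fun j _ hDj => totalDegree_gateVal_le_one P j hDj

/-- Linear combinations preserve the shape "degree `≤ 1` part `+ ∑_p c_p • PV p`". [folklore] -/
theorem exists_affine_add_sum_list {α : Type*} (s : Finset ℕ) (PV : ℕ → MvPolynomial σ k)
    (l : List α) (coef : α → k) (val : α → MvPolynomial σ k)
    (h : ∀ a ∈ l, ∃ (A : MvPolynomial σ k) (c : ℕ → k), A.totalDegree ≤ 1 ∧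
      val a = A + ∑ p ∈ s, c p • PV p) :
    ∃ (A : MvPolynomial σ k) (c : ℕ → k), A.totalDegree ≤ 1 ∧
      (l.map fun a => coef a • val a).sum = A + ∑ p ∈ s, c p • PV p := by
  induction l with
  | nil => exact ⟨0, 0, by simp, by simp⟩
  | cons a l ihl =>
    obtain ⟨A₁, c₁, hA₁, h₁⟩ := h a (by simp)
    obtain ⟨A₂, c₂, hA₂, h₂⟩ := ihl fun b hb => h b (by simp [hb])
    refine ⟨coef a • A₁ + A₂, fun p => coef a * c₁ p + c₂ p, ?_, ?_⟩
    · exact (totalDegree_add _ _).trans (max_le ((totalDegree_smul_le _ _).trans hA₁) hA₂)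
    · rw [List.map_cons, List.sum_cons, h₂, h₁]
      simp only [smul_add, Finset.smul_sum, smul_smul, add_smul, Finset.sum_add_distrib]
      abel

/-- **Sum gates of product-depth `≤ 1`.** Such a gate computes `A + ∑_{p < size} c_p • PV p`
with `A` of total degree `≤ 1`, for ANY assignment `PV` giving the nonempty product gates of
product-depth `≤ 1` their value (empty product gates compute `1` and go into `A`; strong
induction along the gate list). [folklore] -/
theorem exists_affine_add_sum (P : ArithCircuit k σ) (PV : ℕ → MvPolynomial σ k)
    (hPV : ∀ p a l, P.gates[p]? = some (.prod (a :: l)) → P.gatePD p ≤ 1 → PV p = P.gateVal p) :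
    ∀ i l, P.gates[i]? = some (.sum l) → P.gatePD i ≤ 1 →
      ∃ (A : MvPolynomial σ k) (c : ℕ → k), A.totalDegree ≤ 1 ∧
        P.gateVal i = A + ∑ p ∈ Finset.range P.size, c p • PV p := by
  intro i
  induction i using Nat.strong_induction_on with
  | _ i ih =>
    intro l hg hD
    have hiN : i < P.size := (List.getElem?_eq_some_iff.1 hg).1
    rw [P.gateVal_of_sum hg]
    apply exists_affine_add_sum_list (Finset.range P.size) PV l Prod.fst (fun a => P.opVal i a.2)
    intro a ha
    have hdep : P.opPD i a.2 ≤ 1 := (P.opPD_le_gatePD_of_sum hg ha).trans hD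
    rcases a with ⟨ca, u⟩
    dsimp only at hdep ⊢
    cases u with
    | var v => exact ⟨X v, 0, (isHomogeneous_X k v).totalDegree_le, by simp⟩
    | const c => exact ⟨C c, 0, by simp, by simp⟩
    | gate j =>
      rw [opVal_gate]
      rw [opPD_gate] at hdep
      by_cases hj : j < i
      · rw [if_pos hj] at hdep ⊢
        have hjN : j < P.size := lt_trans hj hiN
        obtain ⟨g, hgj⟩ : ∃ g, P.gates[j]? = some g := ⟨_, List.getElem?_eq_getElem hjN⟩
        cases g with
        | sum l' => exact ih j hj l' hgj hdep
        | prod l' =>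
          cases l' with
          | nil => exact ⟨1, 0, by simp, by simp [P.gateVal_of_prod hgj]⟩
          | cons a l' =>
            refine ⟨0, fun p => if p = j then 1 else 0, by simp, ?_⟩
            simp [ite_smul, Finset.sum_ite_eq', hjN, hPV j a l' hgj hdep]
      · rw [if_neg hj]
        exact ⟨0, 0, by simp, by simp⟩

/-- **`ΣΠΣ` normal form of product-depth-one circuits.** A circuit of product-depth `≤ 1` with
`E` wires computes `∑_{i < E+1} ∏_{j < E+1} ℓ i j` for polynomials `ℓ i j` of total degree `≤ 1`
(one row per nonempty product gate of product-depth `≤ 1` — at most `∑ fanIn = E` of them —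
carrying its scalar as a constant factor, plus one row for the degree-`≤ 1` rest; Landsberg 2017
§7.1, BCS 1997 Ch. 21). [folklore] -/
theorem exists_sps_of_productDepth_le_one (P : ArithCircuit k σ) (hP : P.productDepth ≤ 1) :
    ∃ ℓ : Fin (P.edgeSize + 1) → Fin (P.edgeSize + 1) → MvPolynomial σ k,
      (∀ i j, (ℓ i j).totalDegree ≤ 1) ∧ ∑ i, ∏ j, ℓ i j = P.eval := by
  classical
  -- it suffices to produce the rows
  suffices hL : ∃ L : List (List (MvPolynomial σ k)), L.length ≤ P.edgeSize + 1 ∧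
      (∀ row ∈ L, row.length ≤ P.edgeSize + 1) ∧ (∀ row ∈ L, ∀ f ∈ row, f.totalDegree ≤ 1) ∧
      (L.map List.prod).sum = P.eval by
    obtain ⟨L, hL, hrow, hdeg, hsum⟩ := hL
    obtain ⟨ℓ, hℓ, hℓsum⟩ := exists_table_of_rows L hL hrow hdeg
    exact ⟨ℓ, hℓ, hℓsum.trans hsum⟩
  rw [productDepth_eq_opPD_output] at hP
  rw [eval_eq_opVal_output]
  have hE : P.edgeSize = (P.gates.map Gate.fanIn).sum := rfl
  have hfan : ∀ g ∈ P.gates, g.fanIn ≤ P.edgeSize := fun g hg =>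
    List.le_sum_of_mem (List.mem_map.2 ⟨g, hg, rfl⟩)
  cases ho : P.output with
  | var v =>
    refine ⟨[[X v]], by simp, by simp, ?_, by simp⟩
    simpa using (isHomogeneous_X k v).totalDegree_le
  | const c => exact ⟨[[C c]], by simp, by simp, by simp, by simp⟩
  | gate j =>
    rw [ho, opPD_gate] at hP
    rw [opVal_gate]
    by_cases hj : j < P.size
    swap
    · rw [if_neg hj]; exact ⟨[], by simp, by simp, by simp, by simp⟩
    rw [if_pos hj] at hP ⊢
    obtain ⟨g, hg⟩ : ∃ g, P.gates[j]? = some g := ⟨_, List.getElem?_eq_getElem hj⟩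
    cases g with
    | prod l =>
      -- a single product of `fanIn ≤ E` factors of degree `≤ 1`
      refine ⟨[l.map (P.opVal j)], by simp, ?_, ?_, by simp [P.gateVal_of_prod hg]⟩
      · simp only [List.mem_singleton, forall_eq, List.length_map]
        have h := hfan _ (List.mem_of_getElem? hg)
        simp only [Gate.fanIn, Gate.args] at h
        omega
      · simp only [List.mem_singleton, forall_eq]
        intro f hf
        obtain ⟨u, hu, rfl⟩ := List.mem_map.1 hf
        exact totalDegree_opVal_arg_le_one P hg hP u hu
    | sum l =>
      -- the good product gates, their abstract values, the degree-≤1 part and the scalars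
      obtain ⟨Good, hGood⟩ : ∃ Good : ℕ → Prop, ∀ p, Good p ↔
          (∃ a l', P.gates[p]? = some (.prod (a :: l'))) ∧ P.gatePD p ≤ 1 := ⟨_, fun p => Iff.rfl⟩
      obtain ⟨PV, hPVg, hPVb⟩ : ∃ PV : ℕ → MvPolynomial σ k,
          (∀ p, Good p → PV p = P.gateVal p) ∧ (∀ p, ¬ Good p → PV p = 0) :=
        ⟨fun p => if Good p then P.gateVal p else 0, fun p hp => if_pos hp, fun p hp => if_neg hp⟩
      obtain ⟨A, c, hA, hVal⟩ := exists_affine_add_sum P PV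
        (fun p a l' h1 h2 => hPVg p ((hGood p).2 ⟨⟨a, l', h1⟩, h2⟩)) j l hg hP
      obtain ⟨argsOf, hargsOf⟩ : ∃ argsOf : ℕ → List (Operand k σ),
          ∀ p, argsOf p = ((P.gates[p]?).map Gate.args).getD [] := ⟨_, fun p => rfl⟩
      obtain ⟨row, hrowdef⟩ : ∃ row : ℕ → List (MvPolynomial σ k),
          ∀ p, row p = C (c p) :: (argsOf p).map (P.opVal p) := ⟨_, fun p => rfl⟩
      have hargs_good : ∀ p a l', P.gates[p]? = some (.prod (a :: l')) → argsOf p = a :: l' := by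
        intro p a l' h1; simp [hargsOf, h1, Gate.args]
      -- counting the good product gates by their wires
      have hcard : ((Finset.range P.size).filter Good).card ≤ P.edgeSize := by
        calc ((Finset.range P.size).filter Good).card
            = ∑ p ∈ (Finset.range P.size).filter Good, 1 := Finset.card_eq_sum_ones _
          _ ≤ ∑ p ∈ (Finset.range P.size).filter Good, ((P.gates[p]?).map Gate.fanIn).getD 0 := by
              refine Finset.sum_le_sum fun p hp => ?_
              obtain ⟨⟨a, l', h1⟩, -⟩ := (hGood p).1 (Finset.mem_filter.1 hp).2
              simp [h1, Gate.fanIn, Gate.args]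
          _ ≤ ∑ p ∈ Finset.range P.size, ((P.gates[p]?).map Gate.fanIn).getD 0 :=
              Finset.sum_le_sum_of_subset (Finset.filter_subset _ _)
          _ = P.edgeSize := by rw [hE, ← sum_range_getElem?_map_getD]; rfl
      refine ⟨[A] :: ((Finset.range P.size).filter Good).toList.map row, ?_, ?_, ?_, ?_⟩
      · -- number of rows
        simp only [List.length_cons, List.length_map, Finset.length_toList]
        omega
      · -- row lengths
        intro r hr
        rcases List.mem_cons.1 hr with rfl | hr
        · simp
        · obtain ⟨p, hp, rfl⟩ := List.mem_map.1 hr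
          obtain ⟨⟨a, l', h1⟩, -⟩ := (hGood p).1 (Finset.mem_filter.1 (Finset.mem_toList.1 hp)).2
          have h := hfan _ (List.mem_of_getElem? h1)
          simp only [Gate.fanIn, Gate.args, List.length_cons] at h
          simp only [hrowdef, hargs_good p a l' h1, List.length_cons, List.length_map]
          omega
      · -- degrees
        intro r hr
        rcases List.mem_cons.1 hr with rfl | hr
        · simpa using hA
        · obtain ⟨p, hp, rfl⟩ := List.mem_map.1 hr
          obtain ⟨⟨a, l', h1⟩, h2⟩ := (hGood p).1 (Finset.mem_filter.1 (Finset.mem_toList.1 hp)).2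
          intro f hf
          rw [hrowdef, hargs_good p a l' h1] at hf
          rcases List.mem_cons.1 hf with rfl | hf
          · simp
          · obtain ⟨u, hu, rfl⟩ := List.mem_map.1 hf
            exact totalDegree_opVal_arg_le_one P h1 h2 u hu
      · -- the sum
        rw [List.map_cons, List.sum_cons, List.prod_singleton, List.map_map,
          Finset.sum_map_toList, hVal]
        congr 1
        rw [Finset.sum_filter]
        refine Finset.sum_congr rfl fun p _ => ?_
        by_cases hgp : Good p
        · obtain ⟨⟨a, l', h1⟩, -⟩ := (hGood p).1 hgp
          rw [if_pos hgp, Function.comp_apply, hrowdef, hargs_good p a l' h1, List.prod_cons,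
            hPVg p hgp, MvPolynomial.C_mul', P.gateVal_of_prod h1]
        · rw [if_neg hgp, hPVb p hgp, smul_zero]

end Circuits

/-- **`SPSNormalForm`** — settles `stmt-ValiantsHypothesis-5939` (route ChowBorderDepth3, support
item): a product-depth-`≤ 1` circuit with `E` wires computing `per_n` over `ℂ` exhibits `per_n` as
`∑_{i ≤ E} ∏_{j ≤ E} ℓ i j` with every `ℓ i j` of total degree `≤ 1` (depth-`0` gates compute
affine forms, forward references evaluate to `0`, pad with factors `1` and zero rows).
Specialisation of `exists_sps_of_productDepth_le_one` to `k = ℂ`, `σ = Fin n × Fin n`,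
`P.eval = per_n` (Landsberg 2017 §7.1; BCS 1997 Ch. 21). [folklore] -/
theorem SPSNormalForm_proof : Theses.ChowBorderDepth3.SPSNormalForm := by
  unfold Theses.ChowBorderDepth3.SPSNormalForm
  intro n P hP hdepth
  obtain ⟨ℓ, hℓ, hsum⟩ := exists_sps_of_productDepth_le_one P hdepth
  exact ⟨ℓ, hℓ, hsum.trans hP⟩

end Summit.ValiantsHypothesis.ValiantsHypothesis.Theorems
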